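import Summits.HodgeConjecture.HodgeConjecture.Theorems.SixfoldTableXCensusRibetTypeOneRow
import Literature.AlgebraicGeometry.HodgeTheory.UnitaryHodgeGroupPowersHodgeClasses
import Literature.AlgebraicGeometry.Motives.HodgeTensorFactsHolds
import HarnessLib

/-!
# TABLE X (dimension 6) — row 8 `g6.IV(1,1)`, the GENERAL MEMBER (`Hg = U_k`, in particular the `(4,2)` half's general
# member): the census nodes X2 / X1 DISCHARGED IN THE KERNEL on the whole isogeny class, from the tree theorem
# `AbelianVariety.isDivisorGenerated_of_hodgeLieC_unitary` (MZ99 (1.8) ⟹ for `D = k`, Hazama / Murty; Ribet 1983 Thm. 0)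
# with the Lie hypothesis `hU` DISPLAYED (cell `pub-hodgeav-hg6`, req-37 (A) Q2b; eng-4 g5, lead g2 GO 2026-08-28T21:49:30Z)

HONEST FRAMING. HC, `HC_AV` (stmt-1333), `HC_CM` (stmt-3052) and the rung H2 are NOT proved and do not occur here. The
census nodes `TableX.SixfoldCodimTwoCensus` (X2) / `TableX.SixfoldCodimThreeCensus` (X1) of `SixfoldTableXCover` are OURS
(`@[conjecture]`), never asserted. KERNEL ONLY: theorems over existing declarations; no definition, no `sorry`, no named
fact; typed ≠ proved. **General member only: hU is the Lie form of Hg = U_k (MZ99 Table 1 row (4,2) ‘general’); the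
special members (Hg ⊊ U_k) are NOT covered; HC ∕ HC_AV NOT proved.**

WHY THIS MODULE (census-node self-audit, axis A7 «a row VERIFIED in the kernel, not by dossier», continued). L11
(`SixfoldTableXCensusRibetTypeOneRow`, eng-2 g4) put the `(5,1)` HALF of row 8 on A7 for EVERY member (Ribet 1983 Thm. 3,
the tree's `AbelianVariety.isDivisorGenerated_of_ribetTypeOne`). For the `(4,2)` half (`k = ℚ(√-d)` acting on `H^{1,0}`
with multiplicities `(4,2)`, `gcd = 2`, outside Ribet's coprime theorem) the A7 inventory (HOME/jobs/A7-inventory-eng4g4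
§1 row 8) recorded «general-member statement needs a “Hg = U_k(V,ψ)” hypothesis carrier + the `𝔲(4,2)` invariant theory».
Both now exist in the tree as ONE unconditional theorem with the Lie step displayed: the Literature lane's
`AbelianVariety.isDivisorGenerated_of_hodgeLieC_unitary` (`HodgeTheory/UnitaryHodgeGroupPowersHodgeClasses`, this cell's
brick G1; the unitary twin of `SymplecticHodgeGroupPowersHodgeClasses`): for `φ ≫ φ = -d`, `d > 0`, `dim_ℚ End⁰(B) = 2`,
`0 < dim B`, a polarization `ψ` of the `ℚ`-Hodge structure `H¹(B(ℂ); ℚ)` of the tree's Betti universe and the hypothesis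
  `hU`: every `(φ^*)_ℂ`-commuting `ψ_ℂ`-skew operator of `H¹(B(ℂ); ℂ)` lies in `Lie Hg(H¹(B)) ⊗ ℂ`
(`Lie Hg ⊗ ℂ = 𝔲_k(V,ψ) ⊗ ℂ ≅ 𝔤𝔩(W)`, i.e. `Hg(B) = U_k(V,ψ)` — MZ99 (1.8)'s `Hg(X) = Sp_D(V,φ)` for `D = k`), `B = D` holds
on `B` and on every abelian variety with slots over `B`, for ANY multiplicities `(n′, n″)`. THIS FILE feeds that theorem
into L10's entry point `SimpleRows.census_of_isIsogenous_of_isDivisorGenerated`, with `hU` carried VERBATIM as a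
hypothesis of every theorem (spelled `haveI : HodgeTensorFacts := hodgeTensorFacts_holds; ∀ Y, …`, the tree's convention
for Lie hypotheses on the Betti side, cf. `CyclicUnitaryPowersHodgeGenericDeckCommutators`):
* §1 `census_of_isIsogenous_unitaryGeneral` — `B` of Ribet shape (`φ ≫ φ = -(d • 𝟙 B)`, `0 < d`, `finrank_ℚ End⁰(B) = 2`,
  `0 < dim B`) with `hU`: both census conclusions X2-at-`A`, X1-at-`A` hold at every `A ∼ B` (any dimension);
  `hodgeConjectureFor_of_isIsogenous_unitaryGeneral` — L6's CONCLUSION `HodgeConjectureFor` on the whole isogeny class under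
  `hU` (on `B` and its powers it is the tree's `hodgeConjectureFor_powSucc_of_hodgeLieC_unitary` BY NAME).
* §2 `census_row8_unitaryGeneral` — TABLE X row 8, GENERAL MEMBER, KERNEL VERDICT under `hU`: `dim B = 6` and every
  `A ∼ B` is IN THE NODES' DOMAIN `dim A = 6 ∧ ¬ 𝒞 A` (membership is hU-free: L11
  `offResidueSix_of_isIsogenous_ribetTypeOne`) AND satisfies X2-at-`A` ∧ X1-at-`A`; `census_row8_unitaryGeneral_self`.

READING OF `hU` PER SIGNATURE (honest scope). No multiplicity hypothesis appears: `hU` does the work. For `(5,1)` every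
member has `Hg = U_k` (L11 covers the half hU-free; §2 is weaker there). For `(4,2)` `hU` holds for the GENERAL member
(MZ99 Table 1; for ALL members with `End⁰ = k` it is Tankeev 1996 — S-PRINT, no tree theorem; the cell's U-programme
`HodgeThetaSubalgebraUnitary{RadicalKill,Socket,RankIdempotent,RestrictEquiv,…}` aims at exactly `hU`, and when it lands
the `(4,2)` half joins A7 for every member through §2 with `hU` discharged — no further port). For `(3,3)` (row 9) `hU` is
NEVER satisfied (`Hg ⊆ SU_k`: the Weil classes are Hodge classes), so §2 says nothing there — row 9 is L12. The special
members of `(4,2)` with `Hg ⊊ U_k(V,ψ)` (larger endomorphism algebra: rows 10–13, or CM) are other rows. No inhabitant is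
exhibited and none is invented here.

All declarations live in the sub-namespace `TableX.TypeIVRows` (lead g2 DEDUP RULE: import L10/L11 entry points, restate
nothing). Nothing here is a corollary of `HC_CM`; no hypothesis of the cover is discharged GLOBALLY (X2 / X1 quantify over
ALL off-residue sixfolds and stay `@[conjecture]`); typed ≠ proved.
-/

set_option linter.dupNamespace false

noncomputable section

open scoped TensorProduct
open CategoryTheory
open Literature.AlgebraicGeometry Literature.AlgebraicGeometry.Motives
open Literature.AlgebraicGeometry.Motives.AbelianVariety (IsIsogenous IsSimple)
open Literature.AlgebraicGeometry.HodgeTheory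
open Literature.AlgebraicGeometry.Milne1999
open Literature.AlgebraicTopology.SingularHomology
open Literature.Barriers.HodgeConjecture
open Summit.HodgeConjecture.HodgeConjecture.Ring2.ClassTargets
open Summit.HodgeConjecture.HodgeConjecture.Ring2.Motiv (ProdCMCell)
open Summit.HodgeConjecture.HodgeConjecture.Ring2.Atlas (IsQuarticFieldTypeIVFourfold)
open Summit.HodgeConjecture.HodgeConjecture.TableX.SimpleRows

namespace Summit.HodgeConjecture.HodgeConjecture.TableX.TypeIVRows

/-! ## §1 Ribet shape with `Hg = U_k` (Lie form `hU`), any dimension: both census conclusions on the isogeny class -/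

/-- **Both census conclusions X2-at-`A`, X1-at-`A` at every `A` isogenous to a complex abelian variety `B` with
`End⁰(B) = ℚ(√-d)` and `Hg(B) = U_k(H¹(B;ℚ), ψ)`** (Lie form `hU`: every `(φ^*)_ℂ`-commuting `ψ_ℂ`-skew operator of
`H¹(B(ℂ); ℂ)` lies in `Lie Hg ⊗ ℂ`), any multiplicities, any dimension: `B = D` on `B` is the tree's
`AbelianVariety.isDivisorGenerated_of_hodgeLieC_unitary` (MZ99 (1.8) ⟹ for `D = k`: «`Hg(X) = Sp_D(V,φ)` ⟹ `D(Xⁿ) = B(Xⁿ)`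
for all `n`», Hazama / Murty; Ribet 1983 Thm. 0 + FFT for `GL(W)`), and L10's `census_of_isIsogenous_of_isDivisorGenerated`
transports the divisor summand along the isogeny. General member only: hU is the Lie form of Hg = U_k; the special
members (Hg ⊊ U_k) are NOT covered; HC ∕ HC_AV NOT proved. [cite: MoonenZarhin1999LowDim, §1 (1.8), §2 (2.3) and §5 (5.1)]
[cite: Ribet1983, Thm. 0 and Thm. 3] [cite: Gordon1997, Thm. 6.3 (3) (arXiv:alg-geom/9709030 p. 18)]
[cite: vanGeemen1994HodgeAV, §2.4–2.5 and Lemma 3.7] -/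
theorem census_of_isIsogenous_unitaryGeneral {A B : AbelianVariety ℂ} (φ : B ⟶ B) {d : ℕ} (hd : 0 < d)
    (hφ : φ ≫ φ = -(d • 𝟙 B)) (hE2 : Module.finrank ℚ B.endAlgebra = 2) (hB0 : 0 < B.dim)
    (hHD : exists_isReal_hodgeModel) (hI : hodgePQ_independent_of_hodgeModel)
    (ψ : (BettiUniverse.hodge hHD (AbelianVariety.isSmoothProjective_holds (A := B)) 1).Polarization)
    (hU : haveI : HodgeTensorFacts.{0, 0} := hodgeTensorFacts_holds
      ∀ Y : Module.End ℂ (ℂ ⊗[ℚ] bettiCohomology B.X 1),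
        Y * ((bettiCohomology.map φ.hom.hom.hom 1).hom).baseChange ℂ =
            ((bettiCohomology.map φ.hom.hom.hom 1).hom).baseChange ℂ * Y →
          (∀ x y, ψ.form.baseChange ℂ (Y x) y + ψ.form.baseChange ℂ x (Y y) = 0) →
            Y ∈ (BettiUniverse.hodge hHD (AbelianVariety.isSmoothProjective_holds (A := B)) 1).hodgeLieC)
    (hAB : IsIsogenous A B) :
    (∀ c : complexBetti A.X (2 * 2), IsRationalClass c → IsOfHodgeType A.dim A.X (2 * 2) 2 2 c →
      c ∈ divisorClassesSpan A.X A.dim 2 ⊔ Submodule.span ℂ {w' : complexBetti A.X (2 * 2) |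
        ∃ (C : AbelianVariety ℂ) (g : A.X ⟶ C.X) (w : complexBetti C.X (2 * 2)), C.dim < A.dim ∧
          IsRationalClass w ∧ IsOfHodgeType C.dim C.X (2 * 2) 2 2 w ∧ w' = complexBetti.map g (2 * 2) w}) ∧
    (∀ c : complexBetti A.X (2 * 3), IsRationalClass c → IsOfHodgeType A.dim A.X (2 * 3) 3 3 c →
      c ∈ divisorClassesSpan A.X A.dim 3 ⊔ Submodule.span ℂ {w' : complexBetti A.X (2 * 3) |
          ∃ (a : complexBetti A.X (2 * 2)) (b : complexBetti A.X (2 * 1)),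
            IsRationalClass a ∧ IsOfHodgeType A.dim A.X (2 * 2) 2 2 a ∧ IsRationalClass b ∧
            IsOfHodgeType A.dim A.X (2 * 1) 1 1 b ∧ w' = cupProduct (two_mul_add_two_mul 2 1) a b} ⊔
        Submodule.span ℂ {w' : complexBetti A.X (2 * 3) |
          ∃ (C : AbelianVariety ℂ) (g : A.X ⟶ C.X) (w : complexBetti C.X (2 * 3)), C.dim < A.dim ∧
            IsRationalClass w ∧ IsOfHodgeType C.dim C.X (2 * 3) 3 3 w ∧ w' = complexBetti.map g (2 * 3) w} ⊔
        Submodule.span ℂ {w' : complexBetti A.X (2 * 3) |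
          ∃ (B' : AbelianVariety ℂ) (g : A.X ⟶ B'.X) (d : ℕ) (ψ : B' ⟶ B') (w : complexBetti B'.X (2 * 3)),
            B'.dim = 6 ∧ 0 < d ∧ ψ ≫ ψ = -(d • 𝟙 B') ∧ IsRationalClass w ∧
            IsOfHodgeType B'.dim B'.X (2 * 3) 3 3 w ∧ w ∈ weilClassesOf B' ψ 3 d ∧
            w' = complexBetti.map g (2 * 3) w}) :=
  haveI : HodgeTensorFacts.{0, 0} := hodgeTensorFacts_holds
  census_of_isIsogenous_of_isDivisorGenerated hAB
    (AbelianVariety.isDivisorGenerated_of_hodgeLieC_unitary B φ hd hφ hE2 hB0 hHD hI ψ hU)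

/-- **L6's CONCLUSION on the isogeny class under `hU`: the Hodge conjecture holds for every complex abelian variety
isogenous to a `B` with `End⁰(B) = ℚ(√-d)` and `Hg(B) = U_k`** (`B = D` on the model, transported by
`hodgeConjectureFor_of_isIsogenous_of_isDivisorGenerated`; on `B` itself and on its powers this is the tree's
`hodgeConjectureFor_powSucc_of_hodgeLieC_unitary` by name). None of Markman₄ / Markman₆ / R-W6 / X2 / X1 / `HC_CM` enters;
`hU` is displayed, never discharged. General member only: hU is the Lie form of Hg = U_k; the special members (Hg ⊊ U_k)
are NOT covered; HC ∕ HC_AV NOT proved. [cite: MoonenZarhin1999LowDim, §1 (1.7)–(1.8)] [cite: Ribet1983, Thm. 0]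
[cite: vanGeemen1994HodgeAV, §2.4 and Lemma 3.7] -/
theorem hodgeConjectureFor_of_isIsogenous_unitaryGeneral {A B : AbelianVariety ℂ} (φ : B ⟶ B) {d : ℕ} (hd : 0 < d)
    (hφ : φ ≫ φ = -(d • 𝟙 B)) (hE2 : Module.finrank ℚ B.endAlgebra = 2) (hB0 : 0 < B.dim)
    (hHD : exists_isReal_hodgeModel) (hI : hodgePQ_independent_of_hodgeModel)
    (ψ : (BettiUniverse.hodge hHD (AbelianVariety.isSmoothProjective_holds (A := B)) 1).Polarization)
    (hU : haveI : HodgeTensorFacts.{0, 0} := hodgeTensorFacts_holds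
      ∀ Y : Module.End ℂ (ℂ ⊗[ℚ] bettiCohomology B.X 1),
        Y * ((bettiCohomology.map φ.hom.hom.hom 1).hom).baseChange ℂ =
            ((bettiCohomology.map φ.hom.hom.hom 1).hom).baseChange ℂ * Y →
          (∀ x y, ψ.form.baseChange ℂ (Y x) y + ψ.form.baseChange ℂ x (Y y) = 0) →
            Y ∈ (BettiUniverse.hodge hHD (AbelianVariety.isSmoothProjective_holds (A := B)) 1).hodgeLieC)
    (hAB : IsIsogenous A B) : HodgeConjectureFor A.dim A.X :=
  haveI : HodgeTensorFacts.{0, 0} := hodgeTensorFacts_holds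
  hodgeConjectureFor_of_isIsogenous_of_isDivisorGenerated hAB
    (AbelianVariety.isDivisorGenerated_of_hodgeLieC_unitary B φ hd hφ hE2 hB0 hHD hI ψ hU)

/-! ## §2 TABLE X row 8 `g6.IV(1,1)`, GENERAL MEMBER (`Hg = U_k`): kernel verdict with domain membership -/

/-- **TABLE X ROW 8 `g6.IV(1,1)`, GENERAL MEMBER — KERNEL VERDICT on the whole isogeny class under `hU`.** For a complex
abelian SIXFOLD `B` with `φ ∈ End(B)`, `φ ≫ φ = -d` (`d > 0`), `dim_ℚ End⁰(B) = 2` (so `End⁰(B) = ℚ(√-d) = k`, an imaginary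
quadratic field), a polarization `ψ` of `H¹(B(ℂ); ℚ)` and `Hg(B) = U_k(V,ψ)` in the Lie form `hU` (every
`(φ^*)_ℂ`-commuting `ψ_ℂ`-skew operator lies in `Lie Hg ⊗ ℂ`), and for every `A` isogenous to `B`: `dim A = 6` and `A` is
OFF the residue class `𝒞` — `A` is in the domain of the census nodes (hU-free: L11 `offResidueSix_of_isIsogenous_ribetTypeOne`)
—, AND both census conclusions X2-at-`A`, X1-at-`A` hold (§1). No multiplicity hypothesis: for `(5,1)` every member has
`Hg = U_k` and L11 covers the half hU-free; for `(3,3)` `hU` is never satisfied (`Hg ⊆ SU_k`; row 9 = L12); the content is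
the `(4,2)` HALF'S GENERAL MEMBER. General member only: hU is the Lie form of Hg = U_k (MZ99 Table 1 row (4,2)
‘general’); the special members (Hg ⊊ U_k) are NOT covered; HC ∕ HC_AV NOT proved. [cite: MoonenZarhin1999LowDim, §1 (1.8), §2 (2.3)–(2.4) and §5 (5.1)]
[cite: Ribet1983, Thm. 0 and Thm. 3] [cite: Gordon1997, Thm. 6.3 (3) (arXiv:alg-geom/9709030 p. 18)]
[cite: vanGeemen1994HodgeAV, Lemma 3.7] [cite: MumfordAV1970, §19 Cor. 2 of Thm. 1 (p. 174)] [cite: Milne1999, §2 p. 54] -/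
theorem census_row8_unitaryGeneral {A B : AbelianVariety ℂ} (hB : B.dim = 6) (φ : B ⟶ B) {d : ℕ} (hd : 0 < d)
    (hφ : φ ≫ φ = -(d • 𝟙 B)) (hE2 : Module.finrank ℚ B.endAlgebra = 2)
    (hHD : exists_isReal_hodgeModel) (hI : hodgePQ_independent_of_hodgeModel)
    (ψ : (BettiUniverse.hodge hHD (AbelianVariety.isSmoothProjective_holds (A := B)) 1).Polarization)
    (hU : haveI : HodgeTensorFacts.{0, 0} := hodgeTensorFacts_holds
      ∀ Y : Module.End ℂ (ℂ ⊗[ℚ] bettiCohomology B.X 1),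
        Y * ((bettiCohomology.map φ.hom.hom.hom 1).hom).baseChange ℂ =
            ((bettiCohomology.map φ.hom.hom.hom 1).hom).baseChange ℂ * Y →
          (∀ x y, ψ.form.baseChange ℂ (Y x) y + ψ.form.baseChange ℂ x (Y y) = 0) →
            Y ∈ (BettiUniverse.hodge hHD (AbelianVariety.isSmoothProjective_holds (A := B)) 1).hodgeLieC)
    (hAB : IsIsogenous A B) :
    (A.dim = 6 ∧ ¬ (IsOfCMType A ∨ ProdCMCell IsQuarticFieldTypeIVFourfold (fun Z ↦ Z.dim = 2) A)) ∧
    (∀ c : complexBetti A.X (2 * 2), IsRationalClass c → IsOfHodgeType A.dim A.X (2 * 2) 2 2 c →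
      c ∈ divisorClassesSpan A.X A.dim 2 ⊔ Submodule.span ℂ {w' : complexBetti A.X (2 * 2) |
        ∃ (C : AbelianVariety ℂ) (g : A.X ⟶ C.X) (w : complexBetti C.X (2 * 2)), C.dim < A.dim ∧
          IsRationalClass w ∧ IsOfHodgeType C.dim C.X (2 * 2) 2 2 w ∧ w' = complexBetti.map g (2 * 2) w}) ∧
    (∀ c : complexBetti A.X (2 * 3), IsRationalClass c → IsOfHodgeType A.dim A.X (2 * 3) 3 3 c →
      c ∈ divisorClassesSpan A.X A.dim 3 ⊔ Submodule.span ℂ {w' : complexBetti A.X (2 * 3) |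
          ∃ (a : complexBetti A.X (2 * 2)) (b : complexBetti A.X (2 * 1)),
            IsRationalClass a ∧ IsOfHodgeType A.dim A.X (2 * 2) 2 2 a ∧ IsRationalClass b ∧
            IsOfHodgeType A.dim A.X (2 * 1) 1 1 b ∧ w' = cupProduct (two_mul_add_two_mul 2 1) a b} ⊔
        Submodule.span ℂ {w' : complexBetti A.X (2 * 3) |
          ∃ (C : AbelianVariety ℂ) (g : A.X ⟶ C.X) (w : complexBetti C.X (2 * 3)), C.dim < A.dim ∧
            IsRationalClass w ∧ IsOfHodgeType C.dim C.X (2 * 3) 3 3 w ∧ w' = complexBetti.map g (2 * 3) w} ⊔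
        Submodule.span ℂ {w' : complexBetti A.X (2 * 3) |
          ∃ (B' : AbelianVariety ℂ) (g : A.X ⟶ B'.X) (d : ℕ) (ψ : B' ⟶ B') (w : complexBetti B'.X (2 * 3)),
            B'.dim = 6 ∧ 0 < d ∧ ψ ≫ ψ = -(d • 𝟙 B') ∧ IsRationalClass w ∧
            IsOfHodgeType B'.dim B'.X (2 * 3) 3 3 w ∧ w ∈ weilClassesOf B' ψ 3 d ∧
            w' = complexBetti.map g (2 * 3) w}) :=
  ⟨offResidueSix_of_isIsogenous_ribetTypeOne hB φ hd hφ hE2 hAB,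
    census_of_isIsogenous_unitaryGeneral φ hd hφ hE2 (by omega) hHD hI ψ hU hAB⟩

/-- **Row 8, general member, the model itself**: `B` is in the nodes' domain and satisfies X2-at-`B` ∧ X1-at-`B` under
`hU` (the case `A = B` of `census_row8_unitaryGeneral`, `IsIsogenous` being reflexive). General member only: hU is the
Lie form of Hg = U_k; the special members (Hg ⊊ U_k) are NOT covered; HC ∕ HC_AV NOT proved.
[cite: MoonenZarhin1999LowDim, §1 (1.8) and §2 (2.3)] [cite: Ribet1983, Thm. 0] -/
theorem census_row8_unitaryGeneral_self {B : AbelianVariety ℂ} (hB : B.dim = 6) (φ : B ⟶ B) {d : ℕ} (hd : 0 < d)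
    (hφ : φ ≫ φ = -(d • 𝟙 B)) (hE2 : Module.finrank ℚ B.endAlgebra = 2)
    (hHD : exists_isReal_hodgeModel) (hI : hodgePQ_independent_of_hodgeModel)
    (ψ : (BettiUniverse.hodge hHD (AbelianVariety.isSmoothProjective_holds (A := B)) 1).Polarization)
    (hU : haveI : HodgeTensorFacts.{0, 0} := hodgeTensorFacts_holds
      ∀ Y : Module.End ℂ (ℂ ⊗[ℚ] bettiCohomology B.X 1),
        Y * ((bettiCohomology.map φ.hom.hom.hom 1).hom).baseChange ℂ =
            ((bettiCohomology.map φ.hom.hom.hom 1).hom).baseChange ℂ * Y →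
          (∀ x y, ψ.form.baseChange ℂ (Y x) y + ψ.form.baseChange ℂ x (Y y) = 0) →
            Y ∈ (BettiUniverse.hodge hHD (AbelianVariety.isSmoothProjective_holds (A := B)) 1).hodgeLieC) :
    (B.dim = 6 ∧ ¬ (IsOfCMType B ∨ ProdCMCell IsQuarticFieldTypeIVFourfold (fun Z ↦ Z.dim = 2) B)) ∧
    (∀ c : complexBetti B.X (2 * 2), IsRationalClass c → IsOfHodgeType B.dim B.X (2 * 2) 2 2 c →
      c ∈ divisorClassesSpan B.X B.dim 2 ⊔ Submodule.span ℂ {w' : complexBetti B.X (2 * 2) |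
        ∃ (C : AbelianVariety ℂ) (g : B.X ⟶ C.X) (w : complexBetti C.X (2 * 2)), C.dim < B.dim ∧
          IsRationalClass w ∧ IsOfHodgeType C.dim C.X (2 * 2) 2 2 w ∧ w' = complexBetti.map g (2 * 2) w}) ∧
    (∀ c : complexBetti B.X (2 * 3), IsRationalClass c → IsOfHodgeType B.dim B.X (2 * 3) 3 3 c →
      c ∈ divisorClassesSpan B.X B.dim 3 ⊔ Submodule.span ℂ {w' : complexBetti B.X (2 * 3) |
          ∃ (a : complexBetti B.X (2 * 2)) (b : complexBetti B.X (2 * 1)),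
            IsRationalClass a ∧ IsOfHodgeType B.dim B.X (2 * 2) 2 2 a ∧ IsRationalClass b ∧
            IsOfHodgeType B.dim B.X (2 * 1) 1 1 b ∧ w' = cupProduct (two_mul_add_two_mul 2 1) a b} ⊔
        Submodule.span ℂ {w' : complexBetti B.X (2 * 3) |
          ∃ (C : AbelianVariety ℂ) (g : B.X ⟶ C.X) (w : complexBetti C.X (2 * 3)), C.dim < B.dim ∧
            IsRationalClass w ∧ IsOfHodgeType C.dim C.X (2 * 3) 3 3 w ∧ w' = complexBetti.map g (2 * 3) w} ⊔
        Submodule.span ℂ {w' : complexBetti B.X (2 * 3) |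
          ∃ (B' : AbelianVariety ℂ) (g : B.X ⟶ B'.X) (d : ℕ) (ψ : B' ⟶ B') (w : complexBetti B'.X (2 * 3)),
            B'.dim = 6 ∧ 0 < d ∧ ψ ≫ ψ = -(d • 𝟙 B') ∧ IsRationalClass w ∧
            IsOfHodgeType B'.dim B'.X (2 * 3) 3 3 w ∧ w ∈ weilClassesOf B' ψ 3 d ∧
            w' = complexBetti.map g (2 * 3) w}) :=
  census_row8_unitaryGeneral hB φ hd hφ hE2 hHD hI ψ hU (IsIsogenous.refl B)

end Summit.HodgeConjecture.HodgeConjecture.TableX.TypeIVRows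

end
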